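import Literature.NumberTheory.LFunctions.Zhang2022.Section3Lemma36Input
import Literature.NumberTheory.LFunctions.Zhang2022.Section3MeanValues
import Literature.NumberTheory.LFunctions.Zhang2022.Section3ExceptionalSet
import HarnessLib

/-!
# Zhang (2022) §3, Lemma 3.6 — the exceptional-set estimate for `X₄`, assembled (kernel-checked)

Topic `Literature/NumberTheory/LFunctions/Zhang2022` (Landau–Siegel autopsy tree; verdict-neutral;
cell framing: audit + repair census of Zhang arXiv:2211.02515; no claim about Landau–Siegel).
Y. Zhang, *Discrete mean estimates and the Landau–Siegel zero*, arXiv:2211.02515v1 — **an unrefereed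
manuscript, a claimed result under adjudication** — §3 [p. 7 of the held text]. Notation of §2:
`𝓛 = log D` (2.1), `P = exp 𝓛⁹` (2.6), `p ∼ P` iff `P < p < P(1 + 𝓛⁻⁶⁸)`, `Ψ` = all primitive
characters `ψ (mod p)`, `p ∼ P`, `s₀ = ½ + 2πit₀` (2.8), `𝔓 = ∑_{p∼P} p` (2.9); and on p. 7
`ς(n) = ∑_{n = lm, l,m ≤ D⁴} ν(l)υ(m)` (`= 0` unless `n = 1` or `D⁴ < n ≤ D⁸`),
`X₄(x,ψ) = ∑_{D⁴ < n ≤ x} ς(n)ψ(n)n^{-s₀}` for `x > D⁴`: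

> "Assume that (A) holds. By Cauchy's inequality, the first assertion of Lemma 3.2 and Lemma 3.1,
> `∑_{ψ∈Ψ} (|X₄(D⁸,ψ)| + ∫_{D⁴}^{D⁸} |X₄(x,ψ)| dx/x)² ≪ 𝔓𝓛^{-2005}`. Thus we conclude
> **Lemma 3.6.** Assume that (A) holds. The inequality
> `|X₄(D⁸,ψ)| + ∫_{D⁴}^{D⁸} |X₄(x,ψ)| dx/x < 𝓛^{-633}`  (3.6)
> holds for all but at most `O(𝔓𝓛^{-739})` characters `ψ` in `Ψ`."

This file PROVES the displayed second-moment bound and Lemma 3.6 from ingredients already in the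
tree, in three layers; the only number through which the manuscript's Lemma 3.2 (an eight-`L`-factor
moment of subconvex strength — the cell's flag F7) enters Lemma 3.6 is the input
`E = ∑_{D⁴<n≤D⁸} ς(n)²/n`, which is kept as a PARAMETER in layer 2 and instantiated in layer 3.

1. `moment36_le` [folklore: orthogonality + Cauchy–Schwarz against `dx/x` + Chebyshev]: for ANY
   coefficients `a : ℕ → ℂ`, integers `0 < A ≤ B`, any `s ∈ ℂ` and any finite set `M` of moduli
   each `> B`, with `S(N,ψ) = ∑_{A<n≤N} a(n)ψ(n)n^{-s}` (`twist36`),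
   `∑_{p∈M} ∑*_{ψ mod p} (‖S(B,ψ)‖ + ∫_A^B ‖S(⌊x⌋,ψ)‖ dx/x)²
      ≤ (2 + 2 log²(B/A)) · (∑_{p∈M} p) · ∑_{A<n≤B} ‖a(n)‖² n^{-2 Re s}`.
   The mean-value input is the tree's Lemma 3.3(i) `weighted_orthogonality_meanValue`
   (`Section3MeanValues`, implied constant `1`), applied at every height `N ≤ B`; the
   Cauchy–Schwarz step `(∫_A^B g/x)² ≤ log(B/A) · ∫_A^B g²/x` is
   `sq_integral_div_le_log_mul_integral` (discriminant of `t ↦ ∫ (g-t)²/x ≥ 0`; no `L²` theory);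
   counting is `card_filter_mul_sq_le_sum_sq` (`Section3ExceptionalSet`).
2. `lemma_3_6_of_input`: the specialisation `a = ς` (`sigma36 χ` := the tree's
   `sigmaTrunc (nuOf (reChar χ)) (upsilonOf (reChar χ)) D⁴`, `Section3SigmaSplitting`), `A = D⁴`,
   `B = D⁸`, `Re s₀ = ½` (so `n^{-2 Re s₀} = 1/n`, `log(B/A) = 4 log D`, and
   `2 + 32 log²D ≤ 34 log²D` once `log D ≥ 1`): for every `E ≥ ∑_{D⁴<n≤D⁸} ς(n)²/n` the moment is
   `≤ 34 (log D)² 𝔓_M E` and, for every `V > 0`, the number of primitive `ψ` (to moduli in `M`) with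
   `V ≤ |X₄(D⁸,ψ)| + ∫ |X₄| dx/x` is `≤ 34 (log D)² 𝔓_M E / V²`, `𝔓_M = ∑_{p∈M} p`.
3. `lemma_3_6`: Lemma 3.6 under (A) ALONE — `E` instantiated with the tree's INPUT-FREE bound
   `Lemma36Input.lemma_3_6_input'` (`E ≤ C(log D)^{-2007}` for primitive quadratic `χ` with
   `log D ≥ 3` under (A) `‖L(1,χ)‖ ≤ (log D)^{-2022}`, proved there without any subconvexity input,
   ALT-1 variant A11): the moment is `≤ C'𝔓_M(log D)^{-2005}` and the number of exceptional `ψ`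
   (those violating (3.6)) is `≤ C'𝔓_M(log D)^{-739}` (`-2005 + 2·633 = -739`, the tree's
   `lemma36_exponent`), uniformly in `t₀` and over EVERY finite set `M` of moduli `> D⁸`; the
   manuscript's `Ψ` is the case `M = {p prime : p ∼ P}` (`P = exp 𝓛⁹ > D⁸`).

What is NOT claimed: nothing here bears on Lemma 3.2 as printed, on (8.24), or on Theorems 1–2 of
the manuscript; the cell verdict (gap at (8.24), `Zhang2022.not_ineq824`) is untouched. The printed
route to the same input `E` through Lemma 3.2 under a half-line subconvex hypothesis
(`SigmaMajorant.lemma_3_6_input_printed_of_halfLineBound`, `Section3SigmaMajorant`) has the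
conclusion shape of `lemma_3_6_input'` and plugs into `lemma_3_6_of_input` verbatim.

## References

* Y. Zhang, arXiv:2211.02515 (2022), §2 (2.1), (2.6)–(2.9); §3, Lemmas 3.1–3.3, 3.6.
  [cite: Zhang2022LandauSiegel, §3, Lemma 3.6]
-/

noncomputable section

open Finset MeasureTheory

namespace Literature.NumberTheory.LFunctions.Zhang2022.Lemma36

open Literature.NumberTheory.LFunctions.DirichletAbel (reChar)

/-! ### Layer 1: a generic second moment over primitive characters -/

/-- The twisted partial sum `S(N,ψ) = ∑_{A < n ≤ N} a(n) ψ(n) n^{-s}`. [folklore] -/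
def twist36 (a : ℕ → ℂ) (A : ℕ) (s : ℂ) {p : ℕ} (ψ : DirichletCharacter ℂ p) (N : ℕ) : ℂ :=
  ∑ n ∈ Ioc A N, a n * ψ (n : ZMod p) * (n : ℂ) ^ (-s)

open scoped Classical in
/-- Orthogonality at height `N` (the tree's Lemma 3.3(i) `weighted_orthogonality_meanValue` with the
coefficients cut off below `A`): if every modulus in `M` exceeds `N`, then
`∑_{p∈M} ∑*_{ψ mod p} ‖S(N,ψ)‖² ≤ (∑_{p∈M} p) · ∑_{A<n≤N} ‖a(n)‖² n^{-2 Re s}`. [folklore] -/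
theorem twist36_meanSquare_le (a : ℕ → ℂ) (A : ℕ) (s : ℂ) (N : ℕ) (M : Finset ℕ)
    (hM : ∀ p ∈ M, N < p) :
    ∑ p ∈ M, ∑ ψ : DirichletCharacter ℂ p with ψ.IsPrimitive, ‖twist36 a A s ψ N‖ ^ 2 ≤
      (∑ p ∈ M, (p : ℝ)) * ∑ n ∈ Ioc A N, ‖a n‖ ^ 2 * (n : ℝ) ^ (-(2 * s.re)) := by
  have key := weighted_orthogonality_meanValue M N hM (fun n => if A < n then a n else 0) s
  have hsub : Ioc A N ⊆ Ioc 0 N := Ioc_subset_Ioc (Nat.zero_le A) le_rfl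
  have hout : ∀ n ∈ Ioc 0 N, n ∉ Ioc A N → ¬A < n := fun n hn hn' h =>
    hn' (mem_Ioc.mpr ⟨h, (mem_Ioc.mp hn).2⟩)
  have hS : ∀ (p : ℕ) (ψ : DirichletCharacter ℂ p),
      ∑ n ∈ Ioc 0 N, (if A < n then a n else 0) * ψ (n : ZMod p) * (n : ℂ) ^ (-s) =
        twist36 a A s ψ N := by
    intro p ψ
    rw [twist36, ← sum_subset hsub]
    · exact sum_congr rfl fun n hn => by rw [if_pos (mem_Ioc.mp hn).1]
    · intro n hn hn'
      rw [if_neg (hout n hn hn'), zero_mul, zero_mul]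
  have hR : ∑ n ∈ Ioc 0 N, ‖(if A < n then a n else 0)‖ ^ 2 * (n : ℝ) ^ (-(2 * s.re)) =
      ∑ n ∈ Ioc A N, ‖a n‖ ^ 2 * (n : ℝ) ^ (-(2 * s.re)) := by
    rw [← sum_subset hsub]
    · exact sum_congr rfl fun n hn => by rw [if_pos (mem_Ioc.mp hn).1]
    · intro n hn hn'
      rw [if_neg (hout n hn hn'), norm_zero, zero_pow two_ne_zero, zero_mul]
  simp_rw [hS] at key
  rwa [hR] at key

/-- A step function of `⌊x⌋` divided by `x` is integrable on `[a,b]` when `0 < a ≤ b`. [folklore] -/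
theorem intervalIntegrable_natFloor_div (F : ℕ → ℝ) {a b : ℝ} (ha : 0 < a) (hab : a ≤ b) :
    IntervalIntegrable (fun x : ℝ => F ⌊x⌋₊ / x) volume a b := by
  rw [intervalIntegrable_iff_integrableOn_Ioc_of_le hab]
  have hmeas : Measurable fun x : ℝ => F ⌊x⌋₊ / x :=
    ((measurable_from_nat (f := F)).comp Nat.measurable_floor).div measurable_id
  refine Measure.integrableOn_of_bounded (M := (∑ N ∈ range (⌊b⌋₊ + 1), |F N|) / a)
    measure_Ioc_lt_top.ne hmeas.aestronglyMeasurable ?_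
  refine (ae_restrict_iff' measurableSet_Ioc).mpr (ae_of_all _ fun x hx => ?_)
  have hx0 : 0 < x := ha.trans hx.1
  have hfl : ⌊x⌋₊ ∈ range (⌊b⌋₊ + 1) :=
    mem_range.mpr (Nat.lt_succ_of_le (Nat.floor_mono hx.2))
  have h1 : |F ⌊x⌋₊| ≤ ∑ N ∈ range (⌊b⌋₊ + 1), |F N| :=
    single_le_sum (f := fun N => |F N|) (fun N _ => abs_nonneg (F N)) hfl
  rw [Real.norm_eq_abs, abs_div, abs_of_pos hx0]
  exact div_le_div₀ (sum_nonneg fun N _ => abs_nonneg (F N)) h1 ha hx.1.le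

/-- Cauchy–Schwarz against the weight `dx/x` on `[a,b]`, `0 < a ≤ b`:
`(∫_a^b g/x)² ≤ log(b/a) · ∫_a^b g²/x`, proved through the discriminant of the nonnegative
quadratic `t ↦ ∫_a^b (g - t)²/(2x) = ½∫g²/x - t∫g/x + ½t² log(b/a)`. [folklore] -/
theorem sq_integral_div_le_log_mul_integral (g : ℝ → ℝ) {a b : ℝ} (ha : 0 < a) (hab : a ≤ b)
    (hI : IntervalIntegrable (fun x => g x / x) volume a b)
    (hJ : IntervalIntegrable (fun x => g x ^ 2 / x) volume a b) :
    (∫ x in a..b, g x / x) ^ 2 ≤ Real.log (b / a) * ∫ x in a..b, g x ^ 2 / x := by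
  set I := ∫ x in a..b, g x / x with hIdef
  set J := ∫ x in a..b, g x ^ 2 / x with hJdef
  have hL : IntervalIntegrable (fun x : ℝ => x⁻¹) volume a b := by
    refine intervalIntegral.intervalIntegrable_inv (fun x hx => ?_) continuousOn_id
    rw [Set.uIcc_of_le hab] at hx
    exact (ha.trans_le hx.1).ne'
  have hlog : ∫ x in a..b, x⁻¹ = Real.log (b / a) := integral_inv_of_pos ha (ha.trans_le hab)
  -- for every real `t`: `t·I ≤ J/2 + (t²/2)·log(b/a)`
  have hlin : ∀ t : ℝ, t * I ≤ 1 / 2 * J + t ^ 2 / 2 * Real.log (b / a) := by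
    intro t
    have hpt : ∀ x ∈ Set.Icc a b,
        t * (g x / x) ≤ 1 / 2 * (g x ^ 2 / x) + t ^ 2 / 2 * x⁻¹ := by
      intro x hx
      have hx0 : 0 < x := ha.trans_le hx.1
      have e1 : t * (g x / x) = x⁻¹ * (t * g x) := by ring
      have e2 : 1 / 2 * (g x ^ 2 / x) + t ^ 2 / 2 * x⁻¹ = x⁻¹ * ((g x ^ 2 + t ^ 2) / 2) := by ring
      rw [e1, e2]
      exact mul_le_mul_of_nonneg_left (by nlinarith [sq_nonneg (g x - t)]) (inv_nonneg.mpr hx0.le)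
    have hmono := intervalIntegral.integral_mono_on hab (hI.const_mul t)
      ((hJ.const_mul (1 / 2)).add (hL.const_mul (t ^ 2 / 2))) hpt
    rw [intervalIntegral.integral_const_mul, intervalIntegral.integral_add (hJ.const_mul _)
      (hL.const_mul _), intervalIntegral.integral_const_mul, intervalIntegral.integral_const_mul,
      hlog] at hmono
    exact hmono
  have hdisc : discrim (Real.log (b / a) / 2) (-I) (J / 2) ≤ 0 := by
    refine discrim_le_zero fun t => ?_
    have e : Real.log (b / a) / 2 * (t * t) + -I * t + J / 2 =
        (1 / 2 * J + t ^ 2 / 2 * Real.log (b / a)) - t * I := by ring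
    rw [e]
    exact sub_nonneg.mpr (hlin t)
  rw [discrim] at hdisc
  nlinarith [hdisc]

open scoped Classical in
/-- **The second moment of `|S(B,ψ)| + ∫_A^B |S(x,ψ)| dx/x` over primitive characters**
(the display preceding Lemma 3.6, in general form): for `0 < A ≤ B`, every modulus of `M`
exceeding `B`, and any `a`, `s`,
`∑_{p∈M} ∑*_{ψ mod p} (‖S(B,ψ)‖ + ∫_A^B ‖S(⌊x⌋,ψ)‖ dx/x)²
  ≤ (2 + 2 log²(B/A)) (∑_{p∈M} p) ∑_{A<n≤B} ‖a(n)‖² n^{-2 Re s}`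
(`(u+v)² ≤ 2u² + 2v²`, orthogonality at height `B` for `u`, Cauchy–Schwarz in `dx/x` and
orthogonality at every height `⌊x⌋ ≤ B` under the integral for `v`). [folklore] -/
theorem moment36_le (a : ℕ → ℂ) (s : ℂ) {A B : ℕ} (hA : 0 < A) (hAB : A ≤ B) (M : Finset ℕ)
    (hM : ∀ p ∈ M, B < p) :
    ∑ p ∈ M, ∑ ψ : DirichletCharacter ℂ p with ψ.IsPrimitive,
        (‖twist36 a A s ψ B‖ + ∫ x in (A : ℝ)..B, ‖twist36 a A s ψ ⌊x⌋₊‖ / x) ^ 2 ≤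
      (2 + 2 * Real.log ((B : ℝ) / A) ^ 2) * (∑ p ∈ M, (p : ℝ)) *
        ∑ n ∈ Ioc A B, ‖a n‖ ^ 2 * (n : ℝ) ^ (-(2 * s.re)) := by
  set 𝔓 : ℝ := ∑ p ∈ M, (p : ℝ) with h𝔓def
  set W : ℝ := ∑ n ∈ Ioc A B, ‖a n‖ ^ 2 * (n : ℝ) ^ (-(2 * s.re)) with hWdef
  set L : ℝ := Real.log ((B : ℝ) / A) with hLdef
  have ha : (0 : ℝ) < A := Nat.cast_pos.mpr hA
  have hab : (A : ℝ) ≤ B := Nat.cast_le.mpr hAB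
  have hb : (0 : ℝ) < B := ha.trans_le hab
  have h𝔓 : 0 ≤ 𝔓 := sum_nonneg fun p _ => Nat.cast_nonneg p
  have hL0 : 0 ≤ L := Real.log_nonneg ((one_le_div ha).mpr hab)
  have hLint : IntervalIntegrable (fun x : ℝ => x⁻¹) volume A B := by
    refine intervalIntegral.intervalIntegrable_inv (fun x hx => ?_) continuousOn_id
    rw [Set.uIcc_of_le hab] at hx
    exact (ha.trans_le hx.1).ne'
  -- (i) orthogonality at every height `N ≤ B`
  have horth : ∀ N, N ≤ B →
      ∑ p ∈ M, ∑ ψ : DirichletCharacter ℂ p with ψ.IsPrimitive, ‖twist36 a A s ψ N‖ ^ 2 ≤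
        𝔓 * W := by
    intro N hN
    refine (twist36_meanSquare_le a A s N M fun p hp => lt_of_le_of_lt hN (hM p hp)).trans ?_
    exact mul_le_mul_of_nonneg_left (sum_le_sum_of_subset_of_nonneg (Ioc_subset_Ioc le_rfl hN)
      fun n _ _ => mul_nonneg (sq_nonneg _) (Real.rpow_nonneg (Nat.cast_nonneg n) _)) h𝔓
  -- (ii) Cauchy–Schwarz per character
  have hCS : ∀ (p : ℕ) (ψ : DirichletCharacter ℂ p),
      (∫ x in (A : ℝ)..B, ‖twist36 a A s ψ ⌊x⌋₊‖ / x) ^ 2 ≤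
        L * ∫ x in (A : ℝ)..B, ‖twist36 a A s ψ ⌊x⌋₊‖ ^ 2 / x := fun p ψ =>
    sq_integral_div_le_log_mul_integral (fun x => ‖twist36 a A s ψ ⌊x⌋₊‖) ha hab
      (intervalIntegrable_natFloor_div (fun N => ‖twist36 a A s ψ N‖) ha hab)
      (intervalIntegrable_natFloor_div (fun N => ‖twist36 a A s ψ N‖ ^ 2) ha hab)
  -- (iii) the integrated mean square: swap the finite sums with the integral, bound pointwise
  have hint : ∑ p ∈ M, ∑ ψ : DirichletCharacter ℂ p with ψ.IsPrimitive,
      ∫ x in (A : ℝ)..B, ‖twist36 a A s ψ ⌊x⌋₊‖ ^ 2 / x ≤ 𝔓 * W * L := by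
    have hinner : ∀ p ∈ M, ∑ ψ : DirichletCharacter ℂ p with ψ.IsPrimitive,
        ∫ x in (A : ℝ)..B, ‖twist36 a A s ψ ⌊x⌋₊‖ ^ 2 / x =
          ∫ x in (A : ℝ)..B, (∑ ψ : DirichletCharacter ℂ p with ψ.IsPrimitive,
            ‖twist36 a A s ψ ⌊x⌋₊‖ ^ 2) / x := by
      intro p _
      rw [← intervalIntegral.integral_finsetSum fun ψ _ =>
        intervalIntegrable_natFloor_div (fun N => ‖twist36 a A s ψ N‖ ^ 2) ha hab]
      simp only [sum_div]
    have houter : ∑ p ∈ M, ∫ x in (A : ℝ)..B, (∑ ψ : DirichletCharacter ℂ p with ψ.IsPrimitive,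
        ‖twist36 a A s ψ ⌊x⌋₊‖ ^ 2) / x =
          ∫ x in (A : ℝ)..B, (∑ p ∈ M, ∑ ψ : DirichletCharacter ℂ p with ψ.IsPrimitive,
            ‖twist36 a A s ψ ⌊x⌋₊‖ ^ 2) / x := by
      rw [← intervalIntegral.integral_finsetSum fun p _ => intervalIntegrable_natFloor_div
        (fun N => ∑ ψ : DirichletCharacter ℂ p with ψ.IsPrimitive, ‖twist36 a A s ψ N‖ ^ 2) ha hab]
      simp only [sum_div]
    rw [sum_congr rfl hinner, houter]
    calc ∫ x in (A : ℝ)..B, (∑ p ∈ M, ∑ ψ : DirichletCharacter ℂ p with ψ.IsPrimitive,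
          ‖twist36 a A s ψ ⌊x⌋₊‖ ^ 2) / x
        ≤ ∫ x in (A : ℝ)..B, 𝔓 * W * x⁻¹ := by
          refine intervalIntegral.integral_mono_on hab (intervalIntegrable_natFloor_div
            (fun N => ∑ p ∈ M, ∑ ψ : DirichletCharacter ℂ p with ψ.IsPrimitive,
              ‖twist36 a A s ψ N‖ ^ 2) ha hab) (hLint.const_mul _) fun x hx => ?_
          rw [div_eq_mul_inv]
          exact mul_le_mul_of_nonneg_right (horth _ (Nat.floor_le_of_le hx.2))
            (inv_nonneg.mpr (ha.trans_le hx.1).le)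
      _ = 𝔓 * W * L := by
          rw [intervalIntegral.integral_const_mul, integral_inv_of_pos ha hb]
  -- assembly
  calc ∑ p ∈ M, ∑ ψ : DirichletCharacter ℂ p with ψ.IsPrimitive,
        (‖twist36 a A s ψ B‖ + ∫ x in (A : ℝ)..B, ‖twist36 a A s ψ ⌊x⌋₊‖ / x) ^ 2
      ≤ ∑ p ∈ M, ∑ ψ : DirichletCharacter ℂ p with ψ.IsPrimitive,
          (2 * ‖twist36 a A s ψ B‖ ^ 2 +
            2 * L * ∫ x in (A : ℝ)..B, ‖twist36 a A s ψ ⌊x⌋₊‖ ^ 2 / x) := by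
        refine sum_le_sum fun p _ => sum_le_sum fun ψ _ => ?_
        nlinarith [hCS p ψ, sq_nonneg (‖twist36 a A s ψ B‖ -
          ∫ x in (A : ℝ)..B, ‖twist36 a A s ψ ⌊x⌋₊‖ / x)]
    _ = 2 * (∑ p ∈ M, ∑ ψ : DirichletCharacter ℂ p with ψ.IsPrimitive, ‖twist36 a A s ψ B‖ ^ 2) +
          2 * L * ∑ p ∈ M, ∑ ψ : DirichletCharacter ℂ p with ψ.IsPrimitive,
            ∫ x in (A : ℝ)..B, ‖twist36 a A s ψ ⌊x⌋₊‖ ^ 2 / x := by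
        simp only [sum_add_distrib, mul_sum]
    _ ≤ 2 * (𝔓 * W) + 2 * L * (𝔓 * W * L) :=
        add_le_add (mul_le_mul_of_nonneg_left (horth B le_rfl) zero_le_two)
          (mul_le_mul_of_nonneg_left hint (mul_nonneg zero_le_two hL0))
    _ = (2 + 2 * L ^ 2) * 𝔓 * W := by ring

open scoped Classical in
/-- Chebyshev over the family: a second-moment bound `∑_{p∈M} ∑*_{ψ mod p} Y(ψ)² ≤ T` leaves at
most `T/V²` primitive characters (to moduli in `M`) with `Y(ψ) ≥ V`. [folklore] -/
theorem sum_card_filter_le_of_moment36 (M : Finset ℕ) (Y : (p : ℕ) → DirichletCharacter ℂ p → ℝ)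
    {V T : ℝ} (hV : 0 < V)
    (h : ∑ p ∈ M, ∑ ψ : DirichletCharacter ℂ p with ψ.IsPrimitive, Y p ψ ^ 2 ≤ T) :
    ∑ p ∈ M, ((univ.filter fun ψ : DirichletCharacter ℂ p => ψ.IsPrimitive ∧ V ≤ Y p ψ).card : ℝ) ≤
      T / V ^ 2 := by
  rw [le_div_iff₀ (pow_pos hV 2), sum_mul]
  refine le_trans (sum_le_sum fun p _ => ?_) h
  rw [← filter_filter]
  exact card_filter_mul_sq_le_sum_sq _ _ hV.le

/-! ### Layer 2: `ς`, `X₄`, the left side of (3.6), and Lemma 3.6 with the input as a parameter -/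

variable {D : ℕ}

/-- `ς(n)` of the manuscript (p. 7: `ς(n) = ∑_{n=lm, l,m≤D⁴} ν(l)υ(m)`), for the real restriction
`reChar χ` of `χ`: the tree's `sigmaTrunc (nuOf (reChar χ)) (upsilonOf (reChar χ)) D⁴`
(`Section3SigmaSplitting`) — literally the sequence bounded by `Lemma36Input.lemma_3_6_input'`.
[cite: Zhang2022LandauSiegel, §3, Lemma 3.6] -/
def sigma36 (χ : DirichletCharacter ℂ D) (n : ℕ) : ℝ :=
  sigmaTrunc (nuOf (reChar χ)) (upsilonOf (reChar χ)) (D ^ 4) n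

/-- `X₄(N,ψ) = ∑_{D⁴ < n ≤ N} ς(n)ψ(n)n^{-s₀}` (p. 7) at integer height `N`
(`X₄(x,ψ) = X₄(⌊x⌋,ψ)` for real `x`). [cite: Zhang2022LandauSiegel, §3, Lemma 3.6] -/
def X4Sum (χ : DirichletCharacter ℂ D) (s₀ : ℂ) {p : ℕ} (ψ : DirichletCharacter ℂ p) (N : ℕ) : ℂ :=
  twist36 (fun n => (sigma36 χ n : ℂ)) (D ^ 4) s₀ ψ N

/-- The left side of (3.6): `|X₄(D⁸,ψ)| + ∫_{D⁴}^{D⁸} |X₄(x,ψ)| dx/x` (the integration limits are the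
casts of the naturals `D⁴`, `D⁸`, i.e. `(D:ℝ)⁴`, `(D:ℝ)⁸`). [cite: Zhang2022LandauSiegel, §3, Lemma 3.6] -/
def lhs36 (χ : DirichletCharacter ℂ D) (s₀ : ℂ) {p : ℕ} (ψ : DirichletCharacter ℂ p) : ℝ :=
  ‖X4Sum χ s₀ ψ (D ^ 8)‖ + ∫ x in ((D ^ 4 : ℕ) : ℝ)..((D ^ 8 : ℕ) : ℝ), ‖X4Sum χ s₀ ψ ⌊x⌋₊‖ / x

open scoped Classical in
/-- **Lemma 3.6 with its input as a parameter.** For `D ≥ 1` with `log D ≥ 1`, any `χ (mod D)`,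
any `E ≥ ∑_{D⁴<n≤D⁸} ς(n)²/n`, any `s₀` on the critical line and any finite set `M` of moduli
`> D⁸` (`𝔓_M := ∑_{p∈M} p`):
the second moment `∑_{p∈M} ∑*_{ψ mod p} (|X₄(D⁸,ψ)| + ∫_{D⁴}^{D⁸}|X₄(x,ψ)| dx/x)² ≤ 34 (log D)² 𝔓_M E`,
and for every `V > 0` at most `34 (log D)² 𝔓_M E / V²` primitive `ψ` have left side of (3.6) `≥ V`.
The manuscript takes `E ≪ 𝓛^{-2007}` from Lemma 3.2 (eight `L`-factors); the tree supplies it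
input-free (`Lemma36Input.lemma_3_6_input'`, used in `lemma_3_6`) or, on the printed route, under a
half-line subconvex bound (`SigmaMajorant.lemma_3_6_input_printed_of_halfLineBound`).
[cite: Zhang2022LandauSiegel, §3, Lemma 3.6] -/
theorem lemma_3_6_of_input (χ : DirichletCharacter ℂ D) (hD : 0 < D) (hlog : 1 ≤ Real.log D)
    {E : ℝ} (hE : ∑ n ∈ Ioc (D ^ 4) (D ^ 8), sigma36 χ n ^ 2 / n ≤ E)
    (s₀ : ℂ) (hs₀ : s₀.re = 1 / 2) (M : Finset ℕ) (hM : ∀ p ∈ M, D ^ 8 < p) :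
    (∑ p ∈ M, ∑ ψ : DirichletCharacter ℂ p with ψ.IsPrimitive, lhs36 χ s₀ ψ ^ 2 ≤
        34 * Real.log D ^ 2 * (∑ p ∈ M, (p : ℝ)) * E) ∧
      ∀ V : ℝ, 0 < V →
        ∑ p ∈ M, ((univ.filter fun ψ : DirichletCharacter ℂ p =>
            ψ.IsPrimitive ∧ V ≤ lhs36 χ s₀ ψ).card : ℝ) ≤
          34 * Real.log D ^ 2 * (∑ p ∈ M, (p : ℝ)) * E / V ^ 2 := by
  have hA : 0 < D ^ 4 := pow_pos hD 4
  have hAB : D ^ 4 ≤ D ^ 8 := Nat.pow_le_pow_right hD (by norm_num)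
  have hmom := moment36_le (fun n => (sigma36 χ n : ℂ)) s₀ hA hAB M hM
  -- on the critical line the weight is `ς(n)²/n`
  have hW : ∑ n ∈ Ioc (D ^ 4) (D ^ 8), ‖(sigma36 χ n : ℂ)‖ ^ 2 * (n : ℝ) ^ (-(2 * s₀.re)) =
      ∑ n ∈ Ioc (D ^ 4) (D ^ 8), sigma36 χ n ^ 2 / n := by
    refine sum_congr rfl fun n _ => ?_
    rw [Complex.norm_real, Real.norm_eq_abs, sq_abs, hs₀,
      show -(2 * (1 / 2 : ℝ)) = -1 by norm_num, Real.rpow_neg_one, div_eq_mul_inv]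
  -- `log(D⁸/D⁴) = 4 log D`, so the constant is `2 + 32 log²D ≤ 34 log²D`
  have hD' : (D : ℝ) ≠ 0 := Nat.cast_ne_zero.mpr hD.ne'
  have h84 : ((D ^ 8 : ℕ) : ℝ) / ((D ^ 4 : ℕ) : ℝ) = (D : ℝ) ^ 4 := by
    rw [Nat.cast_pow, Nat.cast_pow, div_eq_iff (pow_ne_zero 4 hD')]; ring
  have hlogBA : Real.log (((D ^ 8 : ℕ) : ℝ) / ((D ^ 4 : ℕ) : ℝ)) = 4 * Real.log D := by
    rw [h84, Real.log_pow]; norm_num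
  have hconst : 2 + 2 * Real.log (((D ^ 8 : ℕ) : ℝ) / ((D ^ 4 : ℕ) : ℝ)) ^ 2 ≤
      34 * Real.log D ^ 2 := by
    rw [hlogBA]; nlinarith [hlog]
  have h𝔓 : 0 ≤ ∑ p ∈ M, (p : ℝ) := sum_nonneg fun p _ => Nat.cast_nonneg p
  have hW0 : 0 ≤ ∑ n ∈ Ioc (D ^ 4) (D ^ 8), sigma36 χ n ^ 2 / n :=
    sum_nonneg fun n _ => div_nonneg (sq_nonneg _) (Nat.cast_nonneg n)
  have hmain : ∑ p ∈ M, ∑ ψ : DirichletCharacter ℂ p with ψ.IsPrimitive, lhs36 χ s₀ ψ ^ 2 ≤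
      34 * Real.log D ^ 2 * (∑ p ∈ M, (p : ℝ)) * E := by
    rw [hW] at hmom
    refine hmom.trans ?_
    exact mul_le_mul (mul_le_mul_of_nonneg_right hconst h𝔓) hE hW0
      (mul_nonneg (by positivity) h𝔓)
  exact ⟨hmain, fun V hV => sum_card_filter_le_of_moment36 M (fun p ψ => lhs36 χ s₀ ψ) hV hmain⟩

/-! ### Layer 3: Lemma 3.6 under (A) alone -/

open scoped Classical in
/-- **Lemma 3.6 of the manuscript, under (A) alone (no subconvexity input).** There is an absolute
`C` such that for every `D` with `log D ≥ 3`, every PRIMITIVE `χ (mod D)` with `χ² = 1` satisfying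
(A) `‖L(1,χ)‖ ≤ (log D)^{-2022}`, every `s₀` with `Re s₀ = ½` (in particular the manuscript's
`s₀ = ½ + 2πit₀`), and every finite set `M` of moduli exceeding `D⁸` (in particular the primes
`p ∼ P`, `P = exp 𝓛⁹`), writing `𝔓_M = ∑_{p∈M} p`:
* `∑_{p∈M} ∑*_{ψ mod p} (|X₄(D⁸,ψ)| + ∫_{D⁴}^{D⁸} |X₄(x,ψ)| dx/x)² ≤ C 𝔓_M (log D)^{-2005}`
  (the display before Lemma 3.6), and
* (3.6) `|X₄(D⁸,ψ)| + ∫_{D⁴}^{D⁸} |X₄(x,ψ)| dx/x < (log D)^{-633}` fails for at most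
  `C 𝔓_M (log D)^{-739}` primitive characters `ψ` to moduli in `M` (Lemma 3.6).
The input `∑ ς(n)²/n ≤ C₀(log D)^{-2007}` is `Lemma36Input.lemma_3_6_input'` (input-free, ALT-1
A11); the manuscript obtains it from Lemma 3.2. Verdict-neutral. [cite: Zhang2022LandauSiegel, §3, Lemma 3.6] -/
theorem lemma_3_6 : ∃ C : ℝ, ∀ (D : ℕ) [NeZero D] (χ : DirichletCharacter ℂ D),
    χ.IsPrimitive → χ ^ 2 = 1 → 3 ≤ Real.log D → ‖χ.LFunction 1‖ ≤ 1 / Real.log D ^ 2022 →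
    ∀ s₀ : ℂ, s₀.re = 1 / 2 → ∀ M : Finset ℕ, (∀ p ∈ M, D ^ 8 < p) →
      (∑ p ∈ M, ∑ ψ : DirichletCharacter ℂ p with ψ.IsPrimitive, lhs36 χ s₀ ψ ^ 2 ≤
          C * (∑ p ∈ M, (p : ℝ)) / Real.log D ^ 2005) ∧
        ∑ p ∈ M, ((univ.filter fun ψ : DirichletCharacter ℂ p =>
            ψ.IsPrimitive ∧ 1 / Real.log D ^ 633 ≤ lhs36 χ s₀ ψ).card : ℝ) ≤
          C * (∑ p ∈ M, (p : ℝ)) / Real.log D ^ 739 := by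
  obtain ⟨C, hC⟩ := Lemma36Input.lemma_3_6_input'
  refine ⟨34 * C, fun D _ χ hprim hχ hlog hA s₀ hs₀ M hM => ?_⟩
  have hD : 0 < D := Nat.pos_of_ne_zero (NeZero.ne D)
  have hE := hC D χ hprim hχ hlog hA
  obtain ⟨hmom, hcount⟩ := lemma_3_6_of_input χ hD (by linarith) hE s₀ hs₀ M hM
  have hℓ : 0 < Real.log D := by linarith
  set ℓ := Real.log D with hℓdef
  set 𝔓 := ∑ p ∈ M, (p : ℝ) with h𝔓def
  have hℓ' : ℓ ≠ 0 := hℓ.ne'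
  have h1 : 34 * ℓ ^ 2 * 𝔓 * (C / ℓ ^ 2007) = 34 * C * 𝔓 / ℓ ^ 2005 := by
    field_simp
  have h2 := hcount (1 / ℓ ^ 633) (one_div_pos.mpr (pow_pos hℓ 633))
  have h3 : 34 * ℓ ^ 2 * 𝔓 * (C / ℓ ^ 2007) / (1 / ℓ ^ 633) ^ 2 = 34 * C * 𝔓 / ℓ ^ 739 := by
    field_simp
  refine ⟨?_, ?_⟩
  · rw [← h1]; exact hmom
  · rw [← h3]; exact h2

end Literature.NumberTheory.LFunctions.Zhang2022.Lemma36

end
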